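import Summits.Ventures.WeilGRH.TwistedGramCellCheckC
import HarnessLib

/-!
# GRH arm: twisted format C for COMPLEX characters — the κ-enumeration CELL checker for the door
  `weilPositivityOnChar_of_twistedC_formatC_dataJ` at order `J = 1`, `λ = 1` (kernel functions + soundness + literal `hS` bridge)

Cell `rh-explicit`, WEIL TRACK — GRH ARM (engine seat weil-grh-2 gen10).  Brick 3 of the complex χ-cell lane (bricks 1–2:
`TwistedGramCellSignsC`, `TwistedGramEntryBoxC`).  Enumeration `κ`: index `i ↦ mode p = (i+1)/2` (i odd) / `−i/2` (i even);
records at negative modes are the FLIPPED table records (`IdxRec.flip`; `OffValid.flip`, and for the diagonal fields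
`reDigammaQuarter_even` / `re_deriv_digamma_quarter_neg` / `archExpSumDiag_neg`).  Entry `M(i,i') = twistedGramCBox …`; Schur sum over
the columns `j ∈ [2B−1, 2B₃−1)` with weights `w j = wN[(j+1)/2 − B]·2^{−wbits}`; the door's order-1 two-sided tail for `J = 1`
(the `Fin 1` bracket collapses to `1/(B₃−1)`, both copies of the door's statement coincide):
`U(i,i') = 2·[(1+θ)(1+η) A²/(π² d₀ (B₃−1)) s_i s_{i'} + (1+θ)(1+η⁻¹)/(d₀ (B₃−1)) (s_i F̃_i)(s_{i'} F̃_{i'}) + δ_{ii'} (1+θ⁻¹)(2B−1)/(3 d₀ (B₃−1)³)(4A′|κ_i|/π)²]`,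
`A = π/4 + Σ + C/(π B₃)`, `A′ = π/4 + Σ + C/π`, `F̃_i = (½ Im ψ(¼+iω/2) + Σ_k wt(Re χ sin + Im χ cos)(ω ℓ_k) − T)(κ_i)/π`, `s_i = (−1)^{κ_i}`.
★ `hS_of_checkCellC` — literally the door's `hS` with `J := 1`, `lam := fun _ ↦ 1`, `θ := θN/θD`, `η := ηN/ηD`,
`d₀ := d0N/2^wbits`, `w j := wN[(j+1)/2 − B]/2^wbits`, `M i i' := Re G^χ(κ_i, κ_{i'})`, following `hSe_of_checkCellE` (PsdDyadic.psd_of_checkPsdMid + entrywise `mem_`).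
VALIDATED NUMERICALLY against certc8.py (EXTREMALS/GRH/formatC-complex-J1-CERT/certc-7.2-log2-J1-8x64.json) in the Gen scratch
HOME/rh-explicit-weil-grh-2/lean/gen10/complex/Gen_C7_cell.lean (see RESUME-gen10 ADDENDUM C).
SPLIT (400-line rule, weil-grh-2 gen13): second half of the complex cell checker — soundness parts 3–4 (`psd_of_checkCellC`, `hS_of_checkCellC`) and the kernel-facing front door `weilPositivityOnChar_of_checkCellC`; the kernel functions and parts 1–2 are in `TwistedGramCellCheckC.lean`.
-/

set_option autoImplicit false
set_option linter.style.longLine false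

open Real Complex Finset
open scoped BigOperators ArithmeticFunction.vonMangoldt ComplexConjugate

namespace Summit.Ventures.WeilGRH

open Literature.NumberTheory.LFunctions Literature.NumberTheory.LFunctions.Yoshida1992
open Literature.NumberTheory.LFunctions.Yoshida1992.Encl
open Literature.Analysis.SpecialFunctions Literature.Analysis.ValidatedNumerics.NumericsMP

namespace TwistedEncl

variable {S : ℕ} {a : ℝ} {q : ℕ}
/-! ## Soundness, part 3: the PSD fact in clean form, and (part 4) the bridge to the door's literal `hS` at `J = 1` -/

/-- The real entry of the door's matrix `S(i,i') = Re G^χ(κ_i,κ_{i'}) − Σ_c Re G(κ_i,κ_{2B−1+c}) Re G(κ_{i'},κ_{2B−1+c})/w_c − U(i,i')`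
(clean form: columns indexed by `c < 2(B₃−B)`, weights `wN[c/2]·2^{−wbits}`, tail `uCReal`). [cite: Yoshida1992HermitianForms, §7 pp. 305–312] -/
noncomputable def cellCReal (χ : DirichletCharacter ℂ q) (a : ℝ) (d : CCellData) (e : CTailData) (i i' : ℕ) : ℝ :=
  (twistedGramCoeffC χ a (modeOfIdx i) (modeOfIdx i')).re
    - (∑ c' ∈ Finset.range (2 * (d.B3 - d.B)),
        (twistedGramCoeffC χ a (modeOfIdx i) (modeOfIdx (2 * d.B - 1 + c'))).re *
          (twistedGramCoeffC χ a (modeOfIdx i') (modeOfIdx (2 * d.B - 1 + c'))).re /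
          ((d.wN.getD (c' / 2) 0 : ℝ) / 2 ^ d.wbits))
    - uCReal (∑ k ∈ weilPrimeIndex a, (ArithmeticFunction.vonMangoldt k : ℝ) / Real.sqrt k) (a * (1 + weilArchDensity (2 * a)))
        ((e.θN : ℝ) / e.θD) ((e.ηN : ℝ) / e.ηD) ((d.d0N : ℝ) / 2 ^ d.wbits) d.B d.B3
        (fun i ↦ ((Complex.digamma (1 / 4 + ((freq a (modeOfIdx i) : ℝ) : ℂ) / 2 * Complex.I)).im / 2
          + (∑ k ∈ weilPrimeIndex a, (ArithmeticFunction.vonMangoldt k : ℝ) / Real.sqrt k *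
              ((χ (k : ZMod q)).re * Real.sin (freq a (modeOfIdx i) * Real.log k) +
                (χ (k : ZMod q)).im * Real.cos (freq a (modeOfIdx i) * Real.log k)))
          - archExpSumSin a (modeOfIdx i)) / Real.pi) i i'

/-- Unpack `checkCellCHead`. [cite: Moore1966, Ch. 3 (interval arithmetic: inclusion property)] -/
theorem checkCellCHead_spec {d : CCellData} {e : CTailData} (h : checkCellCHead d e = true) :
    2 ≤ d.B ∧ 2 * d.B ≤ d.B3 ∧ 0 < e.θN ∧ 0 < e.θD ∧ 0 < e.ηN ∧ 0 < e.ηD ∧ 0 < d.d0N ∧ (∀ c < d.B3 - d.B, 0 < d.wN.getD c 0) := by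
  unfold checkCellCHead at h
  simp only [Bool.and_eq_true, decide_eq_true_eq, List.all_eq_true, List.mem_range] at h
  obtain ⟨⟨⟨⟨⟨⟨⟨h1, h2⟩, h3⟩, h4⟩, h5⟩, h6⟩, h7⟩, h8⟩ := h
  exact ⟨h1, h2, h3, h4, h5, h6, h7, h8⟩

/-- Semantics of a checked row range. [cite: Moore1966, Ch. 3 (interval arithmetic: inclusion property)] -/
theorem checkCellCRows_iff {C : Consts} {xs ys : List MI} {LQ : MI} {tab : List IdxRec} {d : CCellData} {e : CTailData}
    {c : ℕ} {ρ : ℤ} {D : List (List ℤ)} {i0 n : ℕ} :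
    checkCellCRows S C xs ys LQ tab d e c ρ D i0 n = true ↔
      ∀ i, i0 ≤ i → i < i0 + n → ∀ i' < 2 * d.B - 1, enclCheck S c ρ (PsdDyadic.getMZ D i i') (cellC S C xs ys LQ tab d e i i') = true := by
  unfold checkCellCRows
  simp only [List.all_eq_true, List.mem_range'_1, List.mem_range, and_imp]

/-- Consecutive row ranges glue (literal indices). [folklore] -/
theorem checkCellCRows_glue {C : Consts} {xs ys : List MI} {LQ : MI} {tab : List IdxRec} {d : CCellData} {e : CTailData}
    {c : ℕ} {ρ : ℤ} {D : List (List ℤ)} {i0 n1 i1 n2 n : ℕ}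
    (h1 : checkCellCRows S C xs ys LQ tab d e c ρ D i0 n1 = true) (h2 : checkCellCRows S C xs ys LQ tab d e c ρ D i1 n2 = true)
    (hi : i1 = i0 + n1) (hn : n = n1 + n2) : checkCellCRows S C xs ys LQ tab d e c ρ D i0 n = true := by
  subst hi hn
  rw [checkCellCRows_iff] at h1 h2 ⊢
  intro i hi1 hi2 i' hi'
  by_cases h : i < i0 + n1
  · exact h1 i hi1 h i' hi'
  · exact h2 i (by omega) (by omega) i' hi'

/-- ★ **The PSD fact of the complex cell (clean form).**  Valid constants / prime data / boxes of `Re χ`, `Im χ` on the listed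
prime powers / `log q` box / table valid below `N ≥ B₃` / `CC ∋ a(1+E(2a))`; header, the full row range and the dyadic PSD
certificate ⇒ `∀ x, 0 ≤ Σ_i Σ_{i'} x_i x_{i'} · cellCReal χ a d e i i'` on `Fin (2B−1)`.  (The door's `hS` at `J = 1`, `λ = 1` is this
statement after the literal identification `cellCReal = M − Σ_j … − U`: `hS_of_checkCellC` below.) [cite: Yoshida1992HermitianForms, §7 pp. 305–312] -/
theorem psd_of_checkCellC (hS : 0 < S) (ha0 : 0 < a) {ks : List PrimeLen} (hks : PrimeData a ks) {C : Consts}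
    (hC : ConstsValid S a ks C) (χ : DirichletCharacter ℂ q) {xs ys : List MI}
    (hx : ∀ i < ks.length, MI.mem S (χ (((ks.getD i default).val : ℕ) : ZMod q)).re (xs.getD i default))
    (hy : ∀ i < ks.length, MI.mem S (χ (((ks.getD i default).val : ℕ) : ZMod q)).im (ys.getD i default))
    {LQ : MI} (hLQ : MI.mem S (Real.log q) LQ) {N : ℕ} {tab : List IdxRec} (hT : TabValid S a ks N tab)
    {d : CCellData} {e : CTailData} (hN : d.B3 ≤ N) (hCC : MI.mem S (a * (1 + weilArchDensity (2 * a))) d.CC)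
    {c : ℕ} {ρ δ : ℤ} {D L : List (List ℤ)} (hh : checkCellCHead d e = true)
    (hrows : checkCellCRows S C xs ys LQ tab d e c ρ D 0 (2 * d.B - 1) = true)
    (hpsd : PsdDyadic.checkPsdMid (2 * d.B - 1) δ ρ D L = true) :
    ∀ x : Fin (2 * d.B - 1) → ℝ, 0 ≤ ∑ i, ∑ i', x i * x i' * cellCReal χ a d e i i' := by
  obtain ⟨hB2, hBB3, hθN, hθD, hηN, hηD, hd0, hw⟩ := checkCellCHead_spec hh
  rw [checkCellCRows_iff] at hrows
  have hmem : ∀ i < 2 * d.B - 1, ∀ i' < 2 * d.B - 1, MI.mem S (cellCReal χ a d e i i') (cellC S C xs ys LQ tab d e i i') := by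
    intro i hi i' hi'
    have hiN : i < 2 * N - 1 := by omega
    have hi'N : i' < 2 * N - 1 := by omega
    unfold cellCReal cellC
    exact MI.mem_sub (MI.mem_sub (mem_entryC hS ha0 hks hC χ hx hy hLQ hT hiN hi'N)
      (mem_schurC hS ha0 hks hC χ hx hy hLQ hT (by omega) hiN hi'N (2 * (d.B3 - d.B)) (by omega)
        (fun c' hc' ↦ hw (c' / 2) (by omega))))
      (mem_uC hS hks hC χ hx hy hT hθN hθD hηN hηD hd0 (by omega) (by omega) hCC hiN hi'N)
  have hnear : ∀ i i' : Fin (2 * d.B - 1), |cellCReal χ a d e i i' - (PsdDyadic.getMZ D i i' : ℝ) * (1 / 2 ^ c)| ≤ (ρ : ℝ) * (1 / 2 ^ c) :=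
    fun i i' ↦ abs_sub_le_of_enclCheck hS (hrows i (Nat.zero_le _) (by simp [i.isLt]) i' i'.isLt) (hmem i i.isLt i' i'.isLt)
  exact PsdDyadic.psd_of_checkPsdMid hpsd (u := 1 / 2 ^ c) (by positivity) (fun i i' ↦ cellCReal χ a d e i i') hnear


/-! ## Soundness, part 4: the door's literal `hS` at `J = 1`, `λ = 1` -/

/-- `(−1)^{κ_i}` as the integer sign `sgnOfIdx i` (exponent written as in the door). [folklore] -/
theorem neg_one_zpow_modeExpr (i : ℕ) :
    (-1 : ℝ) ^ (if i % 2 = 1 then (((i + 1) / 2 : ℕ) : ℤ) else -(((i / 2 : ℕ)) : ℤ)) = ((sgnOfIdx i : ℤ) : ℝ) := by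
  have e : (if i % 2 = 1 then (((i + 1) / 2 : ℕ) : ℤ) else -(((i / 2 : ℕ)) : ℤ)) = modeOfIdx i := rfl
  rw [e]
  unfold sgnOfIdx
  by_cases h : (modeOfIdx i).natAbs % 2 = 0
  · rw [if_pos h]
    have hev : Even (modeOfIdx i) := Int.natAbs_even.mp (Nat.even_iff.mpr h)
    rw [hev.neg_one_zpow]; push_cast; rfl
  · rw [if_neg h]
    have hodd : Odd (modeOfIdx i) := Int.natAbs_odd.mp (Nat.odd_iff.mpr (by omega))
    rw [hodd.neg_one_zpow]; push_cast; rfl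

/-- ★★ **The complex door's kernel fact `hS` from a checked cell** — literally the hypothesis `hS` of
`weilPositivityOnChar_of_twistedC_formatC_dataJ` with `M i i' := Re G^χ(κ_i, κ_{i'})`, `B := d.B`, `B₃ := d.B3`, `J := 1`,
`lam := fun _ ↦ 1`, `θ := θN/θD`, `η := ηN/ηD`, `d₀ := d0N·2^{−wbits}`, `w j := wN[(j+1)/2 − B]·2^{−wbits}`.
[cite: Yoshida1992HermitianForms, §7 pp. 305–312] -/
theorem hS_of_checkCellC (hS : 0 < S) (ha0 : 0 < a) {ks : List PrimeLen} (hks : PrimeData a ks) {C : Consts}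
    (hC : ConstsValid S a ks C) (χ : DirichletCharacter ℂ q) {xs ys : List MI}
    (hx : ∀ i < ks.length, MI.mem S (χ (((ks.getD i default).val : ℕ) : ZMod q)).re (xs.getD i default))
    (hy : ∀ i < ks.length, MI.mem S (χ (((ks.getD i default).val : ℕ) : ZMod q)).im (ys.getD i default))
    {LQ : MI} (hLQ : MI.mem S (Real.log q) LQ) {N : ℕ} {tab : List IdxRec} (hT : TabValid S a ks N tab)
    {d : CCellData} {e : CTailData} (hN : d.B3 ≤ N) (hCC : MI.mem S (a * (1 + weilArchDensity (2 * a))) d.CC)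
    {c : ℕ} {ρ δ : ℤ} {D L : List (List ℤ)} (hh : checkCellCHead d e = true)
    (hrows : checkCellCRows S C xs ys LQ tab d e c ρ D 0 (2 * d.B - 1) = true)
    (hpsd : PsdDyadic.checkPsdMid (2 * d.B - 1) δ ρ D L = true) :
    ∀ x : Fin (2 * d.B - 1) → ℝ, 0 ≤ ∑ i, ∑ i', x i * x i' *
      ((twistedGramCoeffC χ a (modeOfIdx i) (modeOfIdx i')).re - (∑ j ∈ Finset.Ico (2 * d.B - 1) (2 * d.B3 - 1), (twistedGramCoeffC χ a (modeOfIdx i) (modeOfIdx j)).re * (twistedGramCoeffC χ a (modeOfIdx i') (modeOfIdx j)).re / ((d.wN.getD ((j + 1) / 2 - d.B) 0 : ℝ) / 2 ^ d.wbits))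
        - (Matrix.of fun i i' : Fin (2 * d.B - 1) ↦
            ((1 + ((e.θN : ℝ) / e.θD)) * (1 + ((e.ηN : ℝ) / e.ηD)) * ((π / 4 + (∑ k ∈ weilPrimeIndex a, (Λ k : ℝ) / Real.sqrt k) + a * (1 + weilArchDensity (2 * a)) / (π * d.B3)) ^ 2 / (π ^ 2 * ((d.d0N : ℝ) / 2 ^ d.wbits))) * (∑ j : Fin 1, ∑ j' : Fin 1, (((1 / ((((j : ℕ) + 1) + ((j' : ℕ) + 1) - 1 : ℕ) * (((d.B3 - 1 : ℕ) : ℝ)) ^ (((j : ℕ) + 1) + ((j' : ℕ) + 1) - 1)) + 1 / ((((j : ℕ) + 1) + ((j' : ℕ) + 1) - 1 : ℕ) * (d.B3 : ℝ) ^ (((j : ℕ) + 1) + ((j' : ℕ) + 1) - 1))) / 2) + (if j = j' then (∑ j' : Fin 1, ((1 / ((((j : ℕ) + 1) + ((j' : ℕ) + 1) - 1 : ℕ) * (((d.B3 - 1 : ℕ) : ℝ)) ^ (((j : ℕ) + 1) + ((j' : ℕ) + 1) - 1)) - 1 / ((((j : ℕ) + 1) + ((j' : ℕ) + 1) - 1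 : ℕ) * (d.B3 : ℝ) ^ (((j : ℕ) + 1) + ((j' : ℕ) + 1) - 1))) / 2) * (1 : ℝ) / (1 : ℝ)) else 0)) * ((-1 : ℝ) ^ (if (i : ℕ) % 2 = 1 then ((((i : ℕ) + 1) / 2 : ℕ) : ℤ) else -((((i : ℕ) / 2 : ℕ) : ℤ))) * (((if (i : ℕ) % 2 = 1 then ((((i : ℕ) + 1) / 2 : ℕ) : ℤ) else -((((i : ℕ) / 2 : ℕ) : ℤ))) : ℤ) : ℝ) ^ (j : ℕ)) * ((-1 : ℝ) ^ (if (i' : ℕ) % 2 = 1 then ((((i' : ℕ) + 1) / 2 : ℕ) : ℤ) else -((((i' : ℕ) / 2 : ℕ) : ℤ))) * (((if (i' : ℕ) % 2 = 1 then ((((i' : ℕ) + 1) / 2 : ℕ) : ℤ) else -((((i' : ℕ) / 2 : ℕ) : ℤ))) : ℤ) : ℝ) ^ (j' : ℕ)))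
              + (1 + ((e.θN : ℝ) / e.θD)) * (1 + ((e.ηN : ℝ) / e.ηD)⁻¹) * (1 / ((d.d0N : ℝ) / 2 ^ d.wbits)) * (∑ j : Fin 1, ∑ j' : Fin 1, (((1 / ((((j : ℕ) + 1) + ((j' : ℕ) + 1) - 1 : ℕ) * (((d.B3 - 1 : ℕ) : ℝ)) ^ (((j : ℕ) + 1) + ((j' : ℕ) + 1) - 1)) + 1 / ((((j : ℕ) + 1) + ((j' : ℕ) + 1) - 1 : ℕ) * (d.B3 : ℝ) ^ (((j : ℕ) + 1) + ((j' : ℕ) + 1) - 1))) / 2) + (if j = j' then (∑ j' : Fin 1, ((1 / ((((j : ℕ) + 1) + ((j' : ℕ) + 1) - 1 : ℕ) * (((d.B3 - 1 : ℕ) : ℝ)) ^ (((j : ℕ) + 1) + ((j' : ℕ) + 1) - 1)) - 1 / ((((j : ℕ) + 1) + ((j' : ℕ) + 1) - 1 : ℕ) * (d.B3 : ℝ) ^ (((j : ℕ) + 1) + ((j' : ℕ) + 1) - 1))) / 2) * (1 : ℝ) / (1 : ℝ)) else 0)) * ((-1 : ℝ) ^ (if (i : ℕ) % 2 = 1 then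 ((((i : ℕ) + 1) / 2 : ℕ) : ℤ) else -((((i : ℕ) / 2 : ℕ) : ℤ))) * (-((((if (i : ℕ) % 2 = 1 then ((((i : ℕ) + 1) / 2 : ℕ) : ℤ) else -((((i : ℕ) / 2 : ℕ) : ℤ))) : ℤ) : ℝ) ^ (j : ℕ)) * ((Complex.digamma (1 / 4 + ((freq a (if (i : ℕ) % 2 = 1 then ((((i : ℕ) + 1) / 2 : ℕ) : ℤ) else -((((i : ℕ) / 2 : ℕ) : ℤ))) : ℝ) : ℂ) / 2 * I)).im / 2 + (∑ k ∈ weilPrimeIndex a, (Λ k : ℝ) / Real.sqrt k * ((χ (k : ZMod q)).re * Real.sin (freq a (if (i : ℕ) % 2 = 1 then ((((i : ℕ) + 1) / 2 : ℕ) : ℤ) else -((((i : ℕ) / 2 : ℕ) : ℤ))) * Real.log k) + (χ (k : ZMod q)).im * Real.cos (freq a (if (i : ℕ) % 2 = 1 then ((((i : ℕ) + 1) / 2 : ℕ) : ℤ) else -((((i : ℕ) / 2 : ℕ) : ℤ))) * Real.log k))) - archExpSumSin a (if (i : ℕ) % 2 = 1 then ((((i : ℕ) + 1) / 2 : ℕ)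 : ℤ) else -((((i : ℕ) / 2 : ℕ) : ℤ)))) / π)) * ((-1 : ℝ) ^ (if (i' : ℕ) % 2 = 1 then ((((i' : ℕ) + 1) / 2 : ℕ) : ℤ) else -((((i' : ℕ) / 2 : ℕ) : ℤ))) * (-((((if (i' : ℕ) % 2 = 1 then ((((i' : ℕ) + 1) / 2 : ℕ) : ℤ) else -((((i' : ℕ) / 2 : ℕ) : ℤ))) : ℤ) : ℝ) ^ (j' : ℕ)) * ((Complex.digamma (1 / 4 + ((freq a (if (i' : ℕ) % 2 = 1 then ((((i' : ℕ) + 1) / 2 : ℕ) : ℤ) else -((((i' : ℕ) / 2 : ℕ) : ℤ))) : ℝ) : ℂ) / 2 * I)).im / 2 + (∑ k ∈ weilPrimeIndex a, (Λ k : ℝ) / Real.sqrt k * ((χ (k : ZMod q)).re * Real.sin (freq a (if (i' : ℕ) % 2 = 1 then ((((i' : ℕ) + 1) / 2 : ℕ) : ℤ) else -((((i' : ℕ) / 2 : ℕ) : ℤ))) * Real.log k) + (χ (k : ZMod q)).im * Real.cos (freq a (if (i' : ℕ) % 2 = 1 then ((((i' : ℕ) + 1) / 2 : ℕ) : ℤ)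 else -((((i' : ℕ) / 2 : ℕ) : ℤ))) * Real.log k))) - archExpSumSin a (if (i' : ℕ) % 2 = 1 then ((((i' : ℕ) + 1) / 2 : ℕ) : ℤ) else -((((i' : ℕ) / 2 : ℕ) : ℤ)))) / π)))
              + (if i = i' then (1 + ((e.θN : ℝ) / e.θD)⁻¹) * (((2 * d.B - 1 : ℕ) : ℝ) / (((d.d0N : ℝ) / 2 ^ d.wbits) * ((2 * 1 + 1 : ℕ) * (((d.B3 - 1 : ℕ) : ℝ)) ^ (2 * 1 + 1)))) * (4 * (π / 4 + (∑ k ∈ weilPrimeIndex a, (Λ k : ℝ) / Real.sqrt k) + a * (1 + weilArchDensity (2 * a)) / π) * (((if (i : ℕ) % 2 = 1 then ((((i : ℕ) + 1) / 2 : ℕ) : ℤ) else -((((i : ℕ) / 2 : ℕ) : ℤ)))).natAbs : ℝ) ^ 1 / π) ^ 2 else 0))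
            + ((1 + ((e.θN : ℝ) / e.θD)) * (1 + ((e.ηN : ℝ) / e.ηD)) * ((π / 4 + (∑ k ∈ weilPrimeIndex a, (Λ k : ℝ) / Real.sqrt k) + a * (1 + weilArchDensity (2 * a)) / (π * d.B3)) ^ 2 / (π ^ 2 * ((d.d0N : ℝ) / 2 ^ d.wbits))) * (∑ j : Fin 1, ∑ j' : Fin 1, (((1 / ((((j : ℕ) + 1) + ((j' : ℕ) + 1) - 1 : ℕ) * (((d.B3 - 1 : ℕ) : ℝ)) ^ (((j : ℕ) + 1) + ((j' : ℕ) + 1) - 1)) + 1 / ((((j : ℕ) + 1) + ((j' : ℕ) + 1) - 1 : ℕ) * (d.B3 : ℝ) ^ (((j : ℕ) + 1) + ((j' : ℕ) + 1) - 1))) / 2) + (if j = j' then (∑ j' : Fin 1, ((1 / ((((j : ℕ) + 1) + ((j' : ℕ) + 1) - 1 : ℕ) * (((d.B3 - 1 : ℕ) : ℝ)) ^ (((j : ℕ) + 1) + ((j' : ℕ) + 1) - 1)) - 1 / ((((j : ℕ) + 1) + ((j' : ℕ) + 1) - 1 : ℕ) * (d.B3 : ℝ) ^ (((j : ℕ)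 + 1) + ((j' : ℕ) + 1) - 1))) / 2) * (1 : ℝ) / (1 : ℝ)) else 0)) * ((-1 : ℝ) ^ ((j : ℕ) + 1) * ((-1 : ℝ) ^ (if (i : ℕ) % 2 = 1 then ((((i : ℕ) + 1) / 2 : ℕ) : ℤ) else -((((i : ℕ) / 2 : ℕ) : ℤ))) * (((if (i : ℕ) % 2 = 1 then ((((i : ℕ) + 1) / 2 : ℕ) : ℤ) else -((((i : ℕ) / 2 : ℕ) : ℤ))) : ℤ) : ℝ) ^ (j : ℕ))) * ((-1 : ℝ) ^ ((j' : ℕ) + 1) * ((-1 : ℝ) ^ (if (i' : ℕ) % 2 = 1 then ((((i' : ℕ) + 1) / 2 : ℕ) : ℤ) else -((((i' : ℕ) / 2 : ℕ) : ℤ))) * (((if (i' : ℕ) % 2 = 1 then ((((i' : ℕ) + 1) / 2 : ℕ) : ℤ) else -((((i' : ℕ) / 2 : ℕ) : ℤ))) : ℤ) : ℝ) ^ (j' : ℕ))))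
              + (1 + ((e.θN : ℝ) / e.θD)) * (1 + ((e.ηN : ℝ) / e.ηD)⁻¹) * (1 / ((d.d0N : ℝ) / 2 ^ d.wbits)) * (∑ j : Fin 1, ∑ j' : Fin 1, (((1 / ((((j : ℕ) + 1) + ((j' : ℕ) + 1) - 1 : ℕ) * (((d.B3 - 1 : ℕ) : ℝ)) ^ (((j : ℕ) + 1) + ((j' : ℕ) + 1) - 1)) + 1 / ((((j : ℕ) + 1) + ((j' : ℕ) + 1) - 1 : ℕ) * (d.B3 : ℝ) ^ (((j : ℕ) + 1) + ((j' : ℕ) + 1) - 1))) / 2) + (if j = j' then (∑ j' : Fin 1, ((1 / ((((j : ℕ) + 1) + ((j' : ℕ) + 1) - 1 : ℕ) * (((d.B3 - 1 : ℕ) : ℝ)) ^ (((j : ℕ) + 1) + ((j' : ℕ) + 1) - 1)) - 1 / ((((j : ℕ) + 1) + ((j' : ℕ) + 1) - 1 : ℕ) * (d.B3 : ℝ) ^ (((j : ℕ) + 1) + ((j' : ℕ) + 1) - 1))) / 2) * (1 : ℝ) / (1 : ℝ)) else 0)) * ((-1 : ℝ) ^ ((j : ℕ) + 1) * ((-1 :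 ℝ) ^ (if (i : ℕ) % 2 = 1 then ((((i : ℕ) + 1) / 2 : ℕ) : ℤ) else -((((i : ℕ) / 2 : ℕ) : ℤ))) * (-((((if (i : ℕ) % 2 = 1 then ((((i : ℕ) + 1) / 2 : ℕ) : ℤ) else -((((i : ℕ) / 2 : ℕ) : ℤ))) : ℤ) : ℝ) ^ (j : ℕ)) * ((Complex.digamma (1 / 4 + ((freq a (if (i : ℕ) % 2 = 1 then ((((i : ℕ) + 1) / 2 : ℕ) : ℤ) else -((((i : ℕ) / 2 : ℕ) : ℤ))) : ℝ) : ℂ) / 2 * I)).im / 2 + (∑ k ∈ weilPrimeIndex a, (Λ k : ℝ) / Real.sqrt k * ((χ (k : ZMod q)).re * Real.sin (freq a (if (i : ℕ) % 2 = 1 then ((((i : ℕ) + 1) / 2 : ℕ) : ℤ) else -((((i : ℕ) / 2 : ℕ) : ℤ))) * Real.log k) + (χ (k : ZMod q)).im * Real.cos (freq a (if (i : ℕ) % 2 = 1 then ((((i : ℕ) + 1) / 2 : ℕ) : ℤ) else -((((i : ℕ) / 2 : ℕ) : ℤ))) * Real.log k))) - archExpSumSin a (if (i : ℕ) % 2 =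 1 then ((((i : ℕ) + 1) / 2 : ℕ) : ℤ) else -((((i : ℕ) / 2 : ℕ) : ℤ)))) / π))) * ((-1 : ℝ) ^ ((j' : ℕ) + 1) * ((-1 : ℝ) ^ (if (i' : ℕ) % 2 = 1 then ((((i' : ℕ) + 1) / 2 : ℕ) : ℤ) else -((((i' : ℕ) / 2 : ℕ) : ℤ))) * (-((((if (i' : ℕ) % 2 = 1 then ((((i' : ℕ) + 1) / 2 : ℕ) : ℤ) else -((((i' : ℕ) / 2 : ℕ) : ℤ))) : ℤ) : ℝ) ^ (j' : ℕ)) * ((Complex.digamma (1 / 4 + ((freq a (if (i' : ℕ) % 2 = 1 then ((((i' : ℕ) + 1) / 2 : ℕ) : ℤ) else -((((i' : ℕ) / 2 : ℕ) : ℤ))) : ℝ) : ℂ) / 2 * I)).im / 2 + (∑ k ∈ weilPrimeIndex a, (Λ k : ℝ) / Real.sqrt k * ((χ (k : ZMod q)).re * Real.sin (freq a (if (i' : ℕ) % 2 = 1 then ((((i' : ℕ) + 1) / 2 : ℕ) : ℤ) else -((((i' : ℕ) / 2 : ℕ) : ℤ))) * Real.log k) + (χ (k : ZMod q)).im * Real.cos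 (freq a (if (i' : ℕ) % 2 = 1 then ((((i' : ℕ) + 1) / 2 : ℕ) : ℤ) else -((((i' : ℕ) / 2 : ℕ) : ℤ))) * Real.log k))) - archExpSumSin a (if (i' : ℕ) % 2 = 1 then ((((i' : ℕ) + 1) / 2 : ℕ) : ℤ) else -((((i' : ℕ) / 2 : ℕ) : ℤ)))) / π))))
              + (if i = i' then (1 + ((e.θN : ℝ) / e.θD)⁻¹) * (((2 * d.B - 1 : ℕ) : ℝ) / (((d.d0N : ℝ) / 2 ^ d.wbits) * ((2 * 1 + 1 : ℕ) * (((d.B3 - 1 : ℕ) : ℝ)) ^ (2 * 1 + 1)))) * (4 * (π / 4 + (∑ k ∈ weilPrimeIndex a, (Λ k : ℝ) / Real.sqrt k) + a * (1 + weilArchDensity (2 * a)) / π) * (((if (i : ℕ) % 2 = 1 then ((((i : ℕ) + 1) / 2 : ℕ) : ℤ) else -((((i : ℕ) / 2 : ℕ) : ℤ)))).natAbs : ℝ) ^ 1 / π) ^ 2 else 0))) i i') := by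
  obtain ⟨hB2, hBB3, hθN, hθD, hηN, hηD, hd0, hw⟩ := checkCellCHead_spec hh
  intro x
  have key := psd_of_checkCellC hS ha0 hks hC χ hx hy hLQ hT hN hCC hh hrows hpsd x
  refine key.trans_eq (Finset.sum_congr rfl fun i _ ↦ Finset.sum_congr rfl fun i' _ ↦ ?_)
  congr 1
  -- Schur range ↔ Ico
  have hIco : ∀ (f : ℕ → ℝ), ∑ j ∈ Finset.Ico (2 * d.B - 1) (2 * d.B3 - 1), f j =
      ∑ c' ∈ Finset.range (2 * (d.B3 - d.B)), f (2 * d.B - 1 + c') := by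
    intro f
    rw [Finset.sum_Ico_eq_sum_range, show 2 * d.B3 - 1 - (2 * d.B - 1) = 2 * (d.B3 - d.B) by omega]
  have hwIdx : ∀ c' : ℕ, (2 * d.B - 1 + c' + 1) / 2 - d.B = c' / 2 := fun c' ↦ by omega
  rw [hIco]
  simp only [hwIdx, Matrix.of_apply]
  unfold cellCReal uCReal
  by_cases hii : i = i'
  · simp only [modeOfIdx, neg_one_zpow_modeExpr, Fin.sum_univ_one, Fin.val_zero, Fin.isValue, pow_zero, pow_one,
      mul_one, div_one, if_pos hii, if_pos (congrArg Fin.val hii), Nat.cast_natAbs]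
    push_cast
    ring
  · have hii' : (i : ℕ) ≠ (i' : ℕ) := fun h ↦ hii (Fin.ext h)
    simp only [modeOfIdx, neg_one_zpow_modeExpr, Fin.sum_univ_one, Fin.val_zero, Fin.isValue, pow_zero, pow_one,
      mul_one, div_one, hii, hii', if_false]
    push_cast
    ring


/-! ## The kernel-facing front door: data validity + four Boolean checks ⇒ `WeilPositivityOnChar χ a` -/

/-- `κ(ι(p)) = p`: the enumeration index of a mode maps back to the mode. -/
theorem modeOfIdx_iota (p : ℤ) : modeOfIdx (if 0 < p then 2 * p.natAbs - 1 else 2 * p.natAbs) = p := by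
  unfold modeOfIdx
  obtain ⟨n, rfl | rfl⟩ := Int.eq_nat_or_neg p
  · by_cases hn : n = 0
    · subst hn; simp
    · have h0 : (0 : ℤ) < (n : ℤ) := by omega
      rw [if_pos h0, Int.natAbs_natCast]
      have h1 : (2 * n - 1) % 2 = 1 := by omega
      rw [if_pos h1]
      have h2 : (2 * n - 1 + 1) / 2 = n := by omega
      rw [h2]
  · have h0 : ¬ (0 : ℤ) < -(n : ℤ) := by omega
    rw [if_neg h0, Int.natAbs_neg, Int.natAbs_natCast]
    have h1 : ¬ (2 * n) % 2 = 1 := by omega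
    rw [if_neg h1]
    have h2 : 2 * n / 2 = n := by omega
    rw [h2]

/-- ★★ **Front door of the complex χ-cell lane.**  Valid constants / prime data at `a`; boxes `xs ∋ Re χ(k)`, `ys ∋ Im χ(k)` on the
listed prime powers; `LQ ∋ log q`; the special-value table valid below `N > B₃`; `CC ∋ a(1+E(2a))`, `AOP ∋` the prime-operator sum;
and the four kernel checks `checkSignsC` (sign conditions `h0`, `hd0`, `hw` of the door), `checkCellCHead`, `checkCellCRows` (every
entry of `S = M − Schur − U` within `ρ·2^{−c}` of the dyadic midpoint matrix `D`) and `PsdDyadic.checkPsdMid` (`D − δ ≽ 0` with slack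
`≥ ρ` per row) ⇒ **`WeilPositivityOnChar χ a`**, by the data door `weilPositivityOnChar_of_twistedC_formatC_dataJ` at `J = 1`, `λ = 1`
with `M(i,i') = Re G^χ(κ_i, κ_{i'})` (`twistedGramCoeffC_comm` for symmetry, `modeOfIdx_iota` for `hM`).
[cite: Yoshida1992HermitianForms, §7 pp. 305–312] -/
theorem weilPositivityOnChar_of_checkCellC (hq : q ≠ 1) (hS : 0 < S) (ha0 : 0 < a) {Karc : ℕ} {ks : List PrimeLen}
    (hks : PrimeData a ks) {C : Consts} (hC : ConstsValid S a ks C) (χ : DirichletCharacter ℂ q) {xs ys : List MI}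
    (hx : ∀ i < ks.length, MI.mem S (χ (((ks.getD i default).val : ℕ) : ZMod q)).re (xs.getD i default))
    (hy : ∀ i < ks.length, MI.mem S (χ (((ks.getD i default).val : ℕ) : ZMod q)).im (ys.getD i default))
    {LQ : MI} (hLQ : MI.mem S (Real.log q) LQ) {N : ℕ} {tab : List IdxRec} (hT : TabValid S a ks N tab)
    {d : CCellData} {e : CTailData} (hN : d.B3 < N) (hCC : MI.mem S (a * (1 + weilArchDensity (2 * a))) d.CC)
    (hAOP : MI.mem S (∑ k ∈ weilPrimeIndex a, (Λ k : ℝ) / Real.sqrt k * (2 * Real.cos (π / (⌊2 * a / Real.log k⌋₊ + 2)))) d.AOP)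
    (hsg : checkSignsC S Karc C LQ tab d = true)
    {c : ℕ} {ρ δ : ℤ} {D L : List (List ℤ)} (hh : checkCellCHead d e = true)
    (hrows : checkCellCRows S C xs ys LQ tab d e c ρ D 0 (2 * d.B - 1) = true)
    (hpsd : PsdDyadic.checkPsdMid (2 * d.B - 1) δ ρ D L = true) :
    WeilPositivityOnChar χ a := by
  obtain ⟨hB2, hBB3, hθN, hθD, hηN, hηD, -, -⟩ := checkCellCHead_spec hh
  obtain ⟨h0, hd0, hw⟩ := signsC_of_checkSignsC hS ha0 hC hLQ hT hN hCC hAOP hsg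
  have hSS := hS_of_checkCellC hS ha0 hks hC χ hx hy hLQ hT hN.le hCC hh hrows hpsd
  exact weilPositivityOnChar_of_twistedC_formatC_dataJ hq χ ha0
    (fun i i' ↦ (twistedGramCoeffC χ a (modeOfIdx i) (modeOfIdx i')).re)
    (fun j j' ↦ congrArg Complex.re (twistedGramCoeffC_comm χ a _ _))
    (fun p p' ↦ by simp only [modeOfIdx_iota]) hB2 hBB3 1 (fun _ ↦ 1) (fun _ ↦ one_pos)
    (θ := (e.θN : ℝ) / e.θD) (η := (e.ηN : ℝ) / e.ηD) (d₀ := (d.d0N : ℝ) / 2 ^ d.wbits)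
    (div_pos (Nat.cast_pos.mpr hθN) (Nat.cast_pos.mpr hθD)) (div_pos (Nat.cast_pos.mpr hηN) (Nat.cast_pos.mpr hηD))
    (fun j ↦ (d.wN.getD ((j + 1) / 2 - d.B) 0 : ℝ) / 2 ^ d.wbits) h0 hd0 hw hSS

end TwistedEncl

end Summit.Ventures.WeilGRH
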